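import Literature.Claims.NS.ClayVariants
import Literature.Analysis.FluidPDE.LerayHopf
import Literature.Analysis.FluidPDE.WeakSolution
import Literature.Analysis.FunctionSpaces.TorusSobolevNorm
import Literature.Analysis.FunctionSpaces.TorusCalculus
import Literature.Analysis.FunctionSpaces.TorusFluidGlue
import Literature.Analysis.FunctionSpaces.FlatTorus
import Literature.Analysis.FunctionSpaces.Complexify
import Literature.Analysis.FunctionSpaces.TorusSobolevL6Spectral
import Literature.Analysis.FunctionSpaces.TorusSobolevNormProofs
import Literature.Analysis.FunctionSpaces.TorusSobolevNormFacts
import Literature.Analysis.FluidPDE.CriticalSpacesProofs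
import Literature.Analysis.FluidPDE.NSHopfExistenceProofs
import Literature.Analysis.FunctionSpaces.TorusSpaceTimeFields
import Literature.Analysis.FunctionSpaces.TorusSobolevL6
import Literature.Analysis.FluidPDE.ContinuousInLpVersion
import HarnessLib

/-!
# Claim skeleton: Davlatov (2020), «Существование решения уравнения Навье-Стокса»
# («Existence of a solution of the Navier–Stokes equation»), arXiv 1603.09665 v3 (in Russian)

Cell `ns-claims` (D-0090 NS-CLAIMS SWEEP), claim C76, typist `ns-claims-typist-9`.
UNREFEREED/DISPUTED CLAIM under adjudication — NOTHING in this file asserts a step: every `Step…`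
declaration is a `Prop` (the paper's assertion or asserted implication, typed concretely so that
its negation or its vacuity can be a kernel theorem in
`Summits/NavierStokesRegularity/NavierStokesRegularity/Theorems/SoloRefuteDavlatov2020.lean`); the
`theorem`s are the kernel COMPOSITIONS of the paper's own implications.

Version of record (lead ruling 2026-08-26T18:39Z): Ш. О. Давлатов (Shokir O. Davlatov), arXiv:1603.09665
**v3** [math.GM], 30 Dec 2020, 19 pp., in Russian — the latest version carrying the Navier–Stokes claim
(v1 2016-03-25 PDF-only and v2 2016-12-30 argue differently: V := H²- resp. H^{3/2}-closure and an
a-priori estimate (5.3) resting on the norm identity «‖u_m‖²_V = |u_m|² + ‖u_{m2}‖²», v2 p. 10 — a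
PRIOR-VERSION NOTE, not typed; from v4 (2025) on the arXiv identifier is repurposed to unrelated texts).
Bib key `Davlatov2016NSPeriodic`. Print page = arXiv v3 PDF page; TeX lines = `pub/ns-claims/sources/
Davlatov2016/arxiv-1603.09665/v3-utf8.tex`; Russian originals and English renderings of every passage
typed here: `sources/Davlatov2016/TRANSLATION.md` (ns-claims-lit-2), `LIT1-NOTES.md` (ns-claims-lit-1),
locators `LOCATORS.md`.

## Claimed statement (as printed; v3 p. 5, TeX l.250–276)

Problem (2.1)–(2.5), pp. 4–5: the Navier–Stokes system on the cube Ω = (0,l)³ with force f, «without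
loss of generality ρ = 1, ν = 1», periodic conditions (2.3) for u and ∂u/∂x_k, (2.4) for the PRESSURE,
and the normalisation (2.5) ∫_Ω p dx = Q₀; H, V, V₁ = closures of the smooth periodic divergence-free
fields Υ in L², H¹, H² (p. 4). «Теорема 2. При любых u₀ ∈ H и f ∈ L²(0,T;V′) существует слабое решение
u ∈ L²(0,T;V) ∩ L^∞(0,T;H) задачи (2.1)-(2.5).» «**Теорема 3.** Пусть f ∈ C([0,T];H) ∩ L²(0,T;V′),
u₀ ∈ V ∩ (H²(Ω))³. Тогда задача (2.1)-(2.5) имеет единственное слабое решение в C([0,T];V).»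
(«Let f ∈ C([0,T];H) ∩ L²(0,T;V′), u₀ ∈ V ∩ H². Then problem (2.1)–(2.5) has a unique weak solution in
C([0,T];V).») «**Теорема 4.** Для любых u₀ ∈ (H⁴(Ω))³ ∩ V₁ и f ∈ C([0,T];(H²(Ω))³ ∩ V′) и при выполнение
условий (3.1) существует единственное классическое решение u_i ∈ C¹[0,T]×C²(Ω̄), p ∈ C[0,T]×C¹(Ω̄)
задачи (2.1)-(2.5).» («For any u₀ ∈ H⁴ ∩ V₁ and f ∈ C([0,T];H² ∩ V′), under the compatibility
conditions (3.1), there exists a unique classical solution … of (2.1)–(2.5).») Weak solution =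
Definition 2, pp. 6–7 (l.317–325): u ∈ L²(0,T;V) ∩ L^∞(0,T;H), u(0) = u₀, (4.3)/(4.6) for all v ∈ V.
Abstract (all versions): «доказано существование единственного гладкого решения задачи Навье-Стокса с
периодическими краевыми условиями» («the existence of a unique smooth solution of the Navier–Stokes
problem with periodic boundary conditions is proved»; arXiv: «the solution of the sixth millennium
problem»). Typed: `ClaimedTheorem` = Theorem 3 ∧ Theorem 4 on the flat unit torus (see Design).

## Clay delta (reference `ClayVariants.lean`)

Nearest: (B) = `ClayVariants.clayPeriodic.Regularity` (the printed (2.4) makes the pressure periodic —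
the CMI-errata reading, harmless in the regularity direction: `clayPeriodicErrata_regularity_imp_printed`).
Axes: Δ1 domain: periodic cube = torus (=) · Δ2 viscosity ν = 1 «without loss of generality» (on a fixed
period the amplitude–time scaling u ↦ ν⁻¹u(ν⁻¹t) normalises ν; tree: `ClayVariants.clayPeriodic_
regularityAt_iff`) · Δ3 force: GENERAL f ∈ C([0,T];H) — claim STRONGER than (B) (f ≡ 0) · Δ4 data
u₀ ∈ V ∩ H² (Thm 3) / H⁴ ∩ V₁ + (3.1) (Thm 4) ⊇ smooth periodic divergence-free data ((3.1) are
differences of boundary values on opposite faces, void for periodic data) · Δ5 solution notion: weak with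
u ∈ C([0,T];V) (Thm 3), classical C¹ₜC²ₓ (Thm 4); Clay (11) asks C^∞ — bridge = the Thm 6 bootstrap
for every s · Δ6 horizon [0,T] for every T; [0,∞) by uniqueness/patching · Δ7/Δ8 —. The bridge
(transport of a lattice-periodic Clay datum to the unit torus with ν normalised, C^∞ bootstrap, patching)
is typed as `ClayDelta`, with `clay_of_claimed_of_delta : ClayDelta → ClaimedTheorem →
clayPeriodic.Regularity` PROVED. Not a «wrong problem» candidate (claim is (B)-stronger modulo classical
bridges).

## Steps (paper item · print page · TeX lines · typist's private flag)

The proof of Theorem 3 is §6 «1)» (pp. 14–15): (6.1)/(6.2) ⇒ u′ ∈ C([0,T];L¹) ⇒ u ∈ C¹([0,T];H) ⇒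
u′ ∈ C([0,T];H) ⇒ u ∈ C([0,T];V) ⇒ u ∈ C([0,T];L⁶); then 2)–4) (pp. 15–16) uniqueness in L⁴(0,T;L⁶).
Theorem 4 is §7 (pp. 17–18) via Theorem 6 (pp. 16–17). Ordered index (TYPING-HYGIENE 11, 13):
* Step 1 = `Step1_Theorem2` — Thm 2 p. 5 / §5 pp. 10–13: existence of a weak solution (Leray–Hopf /
  Galerkin) — classical; CONSUMED.
* Step 2 = `Step2_Identity62` — (6.1)–(6.2), p. 14 (l.704–725): testing (4.6) with (1,1,1) ∈ V gives
  Σᵢ∫u′ᵢ = Σᵢ∫fᵢ, i.e. the mean identity (6.2) — plausible (classical); CONSUMED.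
* Step 3 = `Step3_TimeDerivL1` — p. 14 (l.716–719) «Если f ∈ C([0,T];H) ∩ L²(0,T;V′) тогда из (6.1)
  следует, что u′ ∈ C([0,T];(L¹(Ω))³)» («If f ∈ C([0,T];H) ∩ L²(0,T;V′) then from (6.1) it follows that
  u′ ∈ C([0,T];(L¹(Ω))³)»), typed at the grain the sentence uses (F15): for ANY u of the weak class with
  the mean identity (6.2) and f ∈ C([0,T];H), u′ ∈ C([0,T];L¹) — SUSPICIOUS ((6.2) constrains three
  numbers per time); LOAD-BEARING (everything after it consumes it); NS-grain twin `Step3_TimeDerivL1_NS`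
  (u a weak solution of (4.4)–(4.7)): there the assertion is a regularity statement for all weak
  solutions; CONSUMED (abstract form).
* Step 4 = `Step4_C1H` — p. 14 (l.748) «Из u′ ∈ C([0,T];(L¹)³) и u ∈ L^∞(0,T;H) следует, что
  u ∈ C¹([0,T];H). Откуда u′ ∈ C([0,T];H).» (with the preceding «u′(0) ∈ H», l.734–748, as an available
  hypothesis) — SUSPICIOUS (class inference without estimate); CONSUMED.
* Step 5 = `Step5_CV` — p. 15 (l.749) «Из u ∈ L²(0,T;V) и u′ ∈ C([0,T];H) следует, что u ∈ C([0,T];V)» —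
  SUSPICIOUS; CONSUMED.
* Step 6 = `Step6_CL6` — p. 15 (l.750) «u ∈ C([0,T];(L⁶)³) поскольку V ⊂ (H¹)³ ⊂ (L⁶)³» — classical
  (Sobolev); support (feeds 4) uniqueness).
* Step 7 = `Step7_Uniqueness` — §6 2)–4), pp. 15–16 (l.752–823), (6.3)–(6.8): uniqueness of weak solutions
  in L⁴(0,T;(L⁶)³) by Gronwall — classical (a Prodi–Serrin class, 2/4 + 3/6 = 1); CONSUMED.
* Step 8 = `Step8_Section7` — Theorem 6 pp. 16–17 (l.831–851, Cattabriga bootstrap) and §7 pp. 17–18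
  (l.858–919): the asserted implication Theorem 3 ⇒ Theorem 4 (spatial bootstrap, Sobolev embedding,
  reconstruction of the periodic normalised pressure) — plausible GIVEN Theorem 3; CONSUMED.

## COMPOSITION — proved as `claim_of_steps`

`claim_of_steps : Step1 → … → Step8 → ClaimedTheorem` — PROVED (short logic); it consumes Steps 1, 2,
3, 4, 5, 7 for Theorem 3 (`theorem3_of_steps`) and Step 8 for Theorem 4; Step 6 is printed support (the
L⁶-continuity feeding 4), whose typed form Step 7 takes C([0,T];V) directly) and is underscored. The
paper's logic COMPOSES; the adjudication is about the truth of Step 3 (then Steps 4, 5), p. 14–15.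

## Design / conventions

* Domain: the flat UNIT torus `UnitAddTorus (Fin 3)` (the paper's cube (0,l)³ with periodic u, ∂u, p;
  period and viscosity normalised, ν = 1 as printed — Δ2 above), tree vocabulary
  `FluidPDE.Torus.IsWeakNSSolutionForcedOn` (weak formulation (4.6)–(4.7) with div-free space–time tests),
  `FunctionSpaces.Torus.MemSobolev / eSobolevNorm / ContinuousInSobolevOn / MemL2Sobolev` (H^s, C([0,T];H^s),
  L²(0,T;H^s), complexified fields), `FunctionSpaces.Torus.IsWeaklyDivFree`, `FluidPDE.ContinuousInLpOn`,
  `FluidPDE.MemLqLp`, torus calculus `FunctionSpaces.Torus.timeDerivWithin / convect / laplacian /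
  gradient / IsDivFree / stLift / lift`.
* H = L² ∩ {weakly div-free} (constants INCLUDED: (1,1,1) ∈ V is used on p. 14), V = H¹ ∩ H, V₁ = H² ∩ H;
  f ∈ C([0,T];H) ∩ L²(0,T;V′) typed as f ∈ C([0,T];L²) with div-free slices (on [0,T], C([0,T];H) ⊂
  L²(0,T;V′)). TODO(general form): V′-valued forces of Theorem 2.
* «u′ ∈ C([0,T];X)», X = L¹ or L² = H: `HasContTimeDerivIn p T u w` — a representative `w ∈ C([0,T];Lᵖ)`
  with `∫⟪u(t) − u(s), φ⟫ = ∫ₛᵗ∫⟪w, φ⟫` for smooth φ (weak time derivative); «u ∈ C¹([0,T];H)» = the case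
  p = 2 (then u′ = w ∈ C([0,T];H), which is how l.748 continues).
* Theorem 4's class «u_i ∈ C¹[0,T]×C²(Ω̄), p ∈ C[0,T]×C¹(Ω̄)» typed as: `stLift u` jointly C¹ on
  [0,T] × ℝ³, slices `lift (u t)` C², `stLift p` continuous, slices `lift (p t)` C¹ (`IsC1C2Solution`);
  the equations pointwise with the torus calculus of `FunctionSpaces.Torus.IsClassicalNSSolutionOn`.

WHAT THIS IS NOT: not a claim about NS regularity or blow-up; not a claim about any author beyond the
typed locator.
-/

open MeasureTheory Set Filter
open scoped ENNReal Topology RealInnerProductSpace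

namespace Literature.Claims.NS.Davlatov2020

open Literature.Analysis
open Literature.Analysis.FunctionSpaces.EuclideanSpace (complexify)

noncomputable section

/-! ## §A. Vocabulary (definitions with bodies; nothing asserted) -/

/-- `u₀ ∈ H` (p. 4 l.178: closure of Υ in L²): square integrable and weakly divergence free.
[cite: Davlatov2016NSPeriodic, §1 p. 4] -/
def InH (v : UnitAddTorus (Fin 3) → EuclideanSpace ℝ (Fin 3)) : Prop :=
  MemLp v 2 (volume : Measure (UnitAddTorus (Fin 3))) ∧ FunctionSpaces.Torus.IsWeaklyDivFree v

/-- `u₀ ∈ V ∩ (H²(Ω))³` (Theorem 3, p. 5): `H²` (spectral, complexified) and weakly divergence free.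
[cite: Davlatov2016NSPeriodic, Thm 3 p. 5; §1 p. 4] -/
def InVcapH2 (v : UnitAddTorus (Fin 3) → EuclideanSpace ℝ (Fin 3)) : Prop :=
  FunctionSpaces.Torus.MemSobolev 2 (complexify ∘ v) ∧ FunctionSpaces.Torus.IsWeaklyDivFree v

/-- `u₀ ∈ (H⁴(Ω))³ ∩ V₁` (Theorem 4, p. 5): `H⁴` and weakly divergence free (V₁ = H²-closure of Υ,
p. 4 l.184). [cite: Davlatov2016NSPeriodic, Thm 4 p. 5; §1 p. 4] -/
def InH4capV1 (v : UnitAddTorus (Fin 3) → EuclideanSpace ℝ (Fin 3)) : Prop :=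
  FunctionSpaces.Torus.MemSobolev 4 (complexify ∘ v) ∧ FunctionSpaces.Torus.IsWeaklyDivFree v

/-- `f ∈ C([0,T];H)` (Theorem 3, p. 5): continuous into `L²` on [0,T] with weakly divergence-free slices
(on the bounded interval this is inside `L²(0,T;V′)`). [cite: Davlatov2016NSPeriodic, Thm 3 p. 5] -/
def ForceClass (T : ℝ) (f : ℝ → UnitAddTorus (Fin 3) → EuclideanSpace ℝ (Fin 3)) : Prop :=
  FluidPDE.ContinuousInLpOn (Icc 0 T) 2 f ∧ ∀ t ∈ Icc 0 T, FunctionSpaces.Torus.IsWeaklyDivFree (f t)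

/-- `f ∈ C([0,T];(H²(Ω))³ ∩ V′)` (Theorem 4, p. 5), typed as `f ∈ C([0,T];H²)` with weakly
divergence-free slices. [cite: Davlatov2016NSPeriodic, Thm 4 p. 5] -/
def ForceClassH2 (T : ℝ) (f : ℝ → UnitAddTorus (Fin 3) → EuclideanSpace ℝ (Fin 3)) : Prop :=
  FunctionSpaces.Torus.ContinuousInSobolevOn (Icc 0 T) 2 (fun t => complexify ∘ f t) ∧
    ∀ t ∈ Icc 0 T, FunctionSpaces.Torus.IsWeaklyDivFree (f t)

/-- The class `L²(0,T;V) ∩ L^∞(0,T;H)` of Definition 2, pp. 6–7 (l.317–318): `u ∈ L^∞(0,T;L²)`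
(a.e.-bounded energy) and `u ∈ L²(0,T;H¹)` (spectral `Torus.MemL2Sobolev`); divergence-freeness is
carried by the weak formulation. [cite: Davlatov2016NSPeriodic, Definition 2 pp. 6–7] -/
def InWeakClass (T : ℝ) (u : ℝ → UnitAddTorus (Fin 3) → EuclideanSpace ℝ (Fin 3)) : Prop :=
  (∃ C : ℝ≥0∞, C < ∞ ∧ ∀ᵐ t ∂(volume.restrict (Ioo 0 T)),
      ∫⁻ x, ‖u t x‖ₑ ^ 2 ∂(volume : Measure (UnitAddTorus (Fin 3))) ≤ C) ∧
    FunctionSpaces.Torus.MemL2Sobolev 0 T 1 (fun t => complexify ∘ u t)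

/-- **Weak solution of (2.1)–(2.5) = problem (4.4)–(4.7)** (Definition 2, pp. 6–7, l.317–345, with
ν = 1): `u ∈ L²(0,T;V) ∩ L^∞(0,T;H)` satisfying the weak identity (4.6) with datum (4.7) `u(0) = u₀`
— typed with the tree's forced weak formulation on the torus (divergence-free space–time test fields;
the pressure is eliminated exactly as (2.4) eliminates `(grad p, φ)`, p. 6 l.298–301).
[cite: Davlatov2016NSPeriodic, Definition 2 pp. 6–7; (4.4)–(4.7) p. 7] -/
def IsWeakSolution (T : ℝ) (f : ℝ → UnitAddTorus (Fin 3) → EuclideanSpace ℝ (Fin 3))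
    (u₀ : UnitAddTorus (Fin 3) → EuclideanSpace ℝ (Fin 3))
    (u : ℝ → UnitAddTorus (Fin 3) → EuclideanSpace ℝ (Fin 3)) : Prop :=
  FluidPDE.Torus.IsWeakNSSolutionForcedOn T 1 f u₀ u ∧ InWeakClass T u

/-- `Σᵢ ∫_Ω vᵢ dx`: the sum of the spatial means of the three components (the quantity of (6.1)–(6.2),
p. 14). [cite: Davlatov2016NSPeriodic, eq. (6.1)–(6.2) p. 14] -/
def meanSum (v : UnitAddTorus (Fin 3) → EuclideanSpace ℝ (Fin 3)) : ℝ :=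
  ∑ i : Fin 3, ∫ x, v x i ∂(volume : Measure (UnitAddTorus (Fin 3)))

/-- The mean identity (6.2), p. 14 (l.720–725) — the integrated form of (6.1)
«Σᵢ∫_Ω u′ᵢ(t) dx = Σᵢ∫_Ω fᵢ(t) dx» ((4.6) tested with (1,1,1) ∈ V): for every t ∈ [0,T],
`Σᵢ∫uᵢ(t) = Σᵢ∫u₀,ᵢ + ∫₀ᵗ Σᵢ∫fᵢ`. [cite: Davlatov2016NSPeriodic, eq. (6.1)–(6.2) p. 14] -/
def Identity62 (T : ℝ) (f : ℝ → UnitAddTorus (Fin 3) → EuclideanSpace ℝ (Fin 3))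
    (u₀ : UnitAddTorus (Fin 3) → EuclideanSpace ℝ (Fin 3))
    (u : ℝ → UnitAddTorus (Fin 3) → EuclideanSpace ℝ (Fin 3)) : Prop :=
  ∀ t ∈ Icc 0 T, meanSum (u t) = meanSum u₀ + ∫ τ in (0 : ℝ)..t, meanSum (f τ)

/-- «u′ = w ∈ C([0,T];Lᵖ(Ω)³)» (p. 14–15: X = L¹ at l.719, X = H = L² at l.748): `w` is continuous on
[0,T] into `Lᵖ` and is the weak time derivative of `u` on [0,T]
(`∫⟪u(t) − u(s), φ⟫ = ∫ₛᵗ∫⟪w(τ), φ⟫ dτ` for every smooth periodic test field φ). For p = 2 this is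
«u ∈ C¹([0,T];H)» with «u′ ∈ C([0,T];H)». [cite: Davlatov2016NSPeriodic, §6 1) pp. 14–15] -/
def HasContTimeDerivIn (p : ℝ≥0∞) (T : ℝ)
    (u w : ℝ → UnitAddTorus (Fin 3) → EuclideanSpace ℝ (Fin 3)) : Prop :=
  FluidPDE.ContinuousInLpOn (Icc 0 T) p w ∧
    ∀ s ∈ Icc 0 T, ∀ t ∈ Icc 0 T, ∀ φ : UnitAddTorus (Fin 3) → EuclideanSpace ℝ (Fin 3),
      FunctionSpaces.Torus.IsSmooth φ →
        ∫ x, ⟪u t x - u s x, φ x⟫ ∂(volume : Measure (UnitAddTorus (Fin 3))) =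
          ∫ τ in s..t, ∫ x, ⟪w τ x, φ x⟫ ∂(volume : Measure (UnitAddTorus (Fin 3)))

/-- «u ∈ C([0,T];V)» (Theorem 3 / p. 15 l.749): continuous into H¹ on [0,T] (spectral, complexified).
[cite: Davlatov2016NSPeriodic, Thm 3 p. 5; p. 15] -/
def InCV (T : ℝ) (u : ℝ → UnitAddTorus (Fin 3) → EuclideanSpace ℝ (Fin 3)) : Prop :=
  FunctionSpaces.Torus.ContinuousInSobolevOn (Icc 0 T) 1 (fun t => complexify ∘ u t)

/-- The classical class of Theorem 4 / Definition 1, pp. 5–6 (l.274–285) «u_i ∈ C¹[0,T]×C²(Ω̄),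
p ∈ C[0,T]×C¹(Ω̄)», satisfying (2.1) with ν = 1 pointwise on [0,T] × Ω, div u = 0, (2.2) u(0) = u₀,
periodicity (2.3)–(2.4) (built into the torus) and the normalisation (2.5) ∫_Ω p = Q₀.
[cite: Davlatov2016NSPeriodic, Definition 1 pp. 5–6; Thm 4 p. 5; (2.1)–(2.5) pp. 4–5] -/
def IsC1C2Solution (T Q₀ : ℝ) (f : ℝ → UnitAddTorus (Fin 3) → EuclideanSpace ℝ (Fin 3))
    (u₀ : UnitAddTorus (Fin 3) → EuclideanSpace ℝ (Fin 3))
    (u : ℝ → UnitAddTorus (Fin 3) → EuclideanSpace ℝ (Fin 3)) (p : ℝ → UnitAddTorus (Fin 3) → ℝ) :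
    Prop :=
  ContDiffOn ℝ 1 (FunctionSpaces.Torus.stLift u) (Icc 0 T ×ˢ univ) ∧
    (∀ t ∈ Icc 0 T, ContDiff ℝ 2 (FunctionSpaces.Torus.lift (u t))) ∧
    ContinuousOn (FunctionSpaces.Torus.stLift p) (Icc 0 T ×ˢ univ) ∧
    (∀ t ∈ Icc 0 T, ContDiff ℝ 1 (FunctionSpaces.Torus.lift (p t))) ∧
    (∀ t ∈ Icc 0 T, ∀ x,
      FunctionSpaces.Torus.timeDerivWithin (Icc 0 T) u t x + FunctionSpaces.Torus.convect (u t) (u t) x =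
        FunctionSpaces.Torus.laplacian (u t) x - FunctionSpaces.Torus.gradient (p t) x + f t x) ∧
    (∀ t ∈ Icc 0 T, FunctionSpaces.Torus.IsDivFree (u t)) ∧
    u 0 = u₀ ∧
    ∀ t ∈ Icc 0 T, ∫ x, p t x ∂(volume : Measure (UnitAddTorus (Fin 3))) = Q₀

/-! ## §B. The claimed statement and its Clay link -/

/-- **Theorem 3, p. 5 (l.254–257), as printed**: for every T > 0, f ∈ C([0,T];H) (∩ L²(0,T;V′)) and
u₀ ∈ V ∩ H², problem (2.1)–(2.5) has a weak solution lying in C([0,T];V), unique in that class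
(«единственное слабое решение в C([0,T];V)»). [cite: Davlatov2016NSPeriodic, Thm 3 p. 5] -/
def Theorem3 : Prop :=
  ∀ T : ℝ, 0 < T →
    ∀ (f : ℝ → UnitAddTorus (Fin 3) → EuclideanSpace ℝ (Fin 3))
      (u₀ : UnitAddTorus (Fin 3) → EuclideanSpace ℝ (Fin 3)), ForceClass T f → InVcapH2 u₀ →
      (∃ u : ℝ → UnitAddTorus (Fin 3) → EuclideanSpace ℝ (Fin 3), IsWeakSolution T f u₀ u ∧ InCV T u) ∧
        ∀ u v : ℝ → UnitAddTorus (Fin 3) → EuclideanSpace ℝ (Fin 3),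
          IsWeakSolution T f u₀ u → InCV T u → IsWeakSolution T f u₀ v → InCV T v →
            ∀ t ∈ Icc 0 T, u t =ᵐ[volume] v t

/-- **Theorem 4, pp. 5–6 (l.259–275), as printed** (torus rendering: the compatibility conditions (3.1)
are identities between boundary values on opposite faces of the cube and are void for periodic data and
forces): for every T > 0, Q₀, u₀ ∈ H⁴ ∩ V₁ and f ∈ C([0,T];H² ∩ V′) there is exactly one classical
solution of class C¹ₜC²ₓ × CₜC¹ₓ of (2.1)–(2.5) (uniqueness of the velocity and, given (2.5), of the
pressure, p. 18 l.917). [cite: Davlatov2016NSPeriodic, Thm 4 pp. 5–6; §7 p. 18 l.917] -/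
def Theorem4 : Prop :=
  ∀ T Q₀ : ℝ, 0 < T →
    ∀ (f : ℝ → UnitAddTorus (Fin 3) → EuclideanSpace ℝ (Fin 3))
      (u₀ : UnitAddTorus (Fin 3) → EuclideanSpace ℝ (Fin 3)), ForceClassH2 T f → InH4capV1 u₀ →
      (∃ (u : ℝ → UnitAddTorus (Fin 3) → EuclideanSpace ℝ (Fin 3)) (p : ℝ → UnitAddTorus (Fin 3) → ℝ),
          IsC1C2Solution T Q₀ f u₀ u p) ∧
        ∀ (u v : ℝ → UnitAddTorus (Fin 3) → EuclideanSpace ℝ (Fin 3)) (p q : ℝ → UnitAddTorus (Fin 3) → ℝ),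
          IsC1C2Solution T Q₀ f u₀ u p → IsC1C2Solution T Q₀ f u₀ v q →
            ∀ t ∈ Icc 0 T, u t = v t ∧ p t = q t

/-- **The claimed theorems of v3, as printed** (p. 5): Theorem 3 ∧ Theorem 4 (Theorem 2 = Leray–Hopf
existence is classical and is `Step1_Theorem2`). [cite: Davlatov2016NSPeriodic, Thms 3–4 p. 5] -/
def ClaimedTheorem : Prop :=
  Theorem3 ∧ Theorem4

/-- **Clay delta** (TYPING-HYGIENE 10 (b); axes Δ2 viscosity normalisation, Δ5 C^∞ bootstrap, Δ6
patching of [0,T] to [0,∞), and the transport torus ↔ lattice-periodic fields on ℝ³ of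
`ClayVariants.lean` §3): the classical bridge under which Theorem 4's conclusion SHAPE decides Clay (B).
For every ν > 0 and every Clay (B) datum u₀ on ℝ³ (smooth, divergence free, ℤ³-periodic) there is a torus
datum ũ₀ ∈ H⁴ ∩ V₁ (its transport with ν normalised) such that: IF for every T > 0 problem (2.1)–(2.5)
with f ≡ 0, Q₀ = 1 has a unique C¹ₜC²ₓ classical solution from ũ₀ on [0,T], THEN the Clay periodic
problem at viscosity ν is solvable from u₀ (`clayPeriodic.Solvable`). Not a claim of the paper.
[cite: FeffermanClay2006, (B) with (8) (10) (11), p. 2] -/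
def ClayDelta : Prop :=
  ∀ ν : ℝ, 0 < ν →
    ∀ u₀ : EuclideanSpace ℝ (Fin 3) → EuclideanSpace ℝ (Fin 3),
      ContDiff ℝ ((⊤ : ℕ∞) : WithTop ℕ∞) u₀ → FluidPDE.NSWave0.IsDivFree u₀ → FluidPDE.IsLatticePeriodic u₀ →
        ∃ v₀ : UnitAddTorus (Fin 3) → EuclideanSpace ℝ (Fin 3), InH4capV1 v₀ ∧
          ((∀ T : ℝ, 0 < T →
              (∃ (u : ℝ → UnitAddTorus (Fin 3) → EuclideanSpace ℝ (Fin 3))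
                  (p : ℝ → UnitAddTorus (Fin 3) → ℝ), IsC1C2Solution T 1 0 v₀ u p) ∧
                ∀ (u v : ℝ → UnitAddTorus (Fin 3) → EuclideanSpace ℝ (Fin 3))
                  (p q : ℝ → UnitAddTorus (Fin 3) → ℝ),
                  IsC1C2Solution T 1 0 v₀ u p → IsC1C2Solution T 1 0 v₀ v q →
                    ∀ t ∈ Icc 0 T, u t = v t ∧ p t = q t) →
            ClayVariants.clayPeriodic.Solvable ν 0 u₀)

/-- The zero force is in the class `C([0,T];H² ∩ V′)` (bookkeeping for the Clay link: constant family of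
the zero field; `eSobolevNorm s 0 = 0`, the zero field is weakly divergence free).
[cite: Davlatov2016NSPeriodic, Thm 4 p. 5] -/
def ZeroForceInClass : Prop :=
  ∀ T : ℝ, 0 < T → ForceClassH2 T 0

/-- Under `ClayDelta` (and the bookkeeping fact that f ≡ 0 is an admissible force), the claimed
theorems imply Clay (B) (`ClayVariants.clayPeriodic.Regularity`). Pure logic.
[cite: FeffermanClay2006, (B) p. 2] -/
theorem clay_of_claimed_of_delta (hΔ : ClayDelta) (h0 : ZeroForceInClass) (hC : ClaimedTheorem) :
    ClayVariants.clayPeriodic.Regularity := by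
  intro ν hν u₀ hsmooth hdiv hper
  obtain ⟨v₀, hv₀, hbridge⟩ := hΔ ν hν u₀ hsmooth hdiv hper
  refine hbridge fun T hT => ?_
  exact hC.2 T 1 hT 0 v₀ (h0 T hT) hv₀

/-! ## §C. The steps -/

/-- **Step 1 — Theorem 2, p. 5 (l.251–252), proved in §5 pp. 10–13 (Galerkin with the special basis
incl. the constants w₁, w₂, w₃; standard Leray–Hopf):** «При любых u₀ ∈ H и f ∈ L²(0,T;V′) существует
слабое решение u ∈ L²(0,T;V) ∩ L^∞(0,T;H)» — typed for forces of the class of Theorem 3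
(TODO(general form): V′-valued f). Typist's flag: classical (Leray 1934 / Hopf 1951 / Temam III.3.1).
[cite: Davlatov2016NSPeriodic, Thm 2 p. 5; §5 pp. 10–13] -/
def Step1_Theorem2 : Prop :=
  ∀ T : ℝ, 0 < T →
    ∀ (f : ℝ → UnitAddTorus (Fin 3) → EuclideanSpace ℝ (Fin 3))
      (u₀ : UnitAddTorus (Fin 3) → EuclideanSpace ℝ (Fin 3)), ForceClass T f → InH u₀ →
      ∃ u : ℝ → UnitAddTorus (Fin 3) → EuclideanSpace ℝ (Fin 3), IsWeakSolution T f u₀ u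

/-- **Step 2 — (6.1)–(6.2), p. 14 (l.704–725):** «(1,1,1) ∈ V and hence in (4.6) we put the vector
(1,1,1) in place of v and obtain (6.1) Σᵢ∫_Ω u′ᵢ(t) dx = Σᵢ∫_Ω fᵢ(t) dx. Obviously the solutions
u ∈ L²(0,T;V) ∩ L^∞(0,T;H) of (4.4)–(4.7) satisfy (6.1)», written as (6.2): every weak solution
satisfies the mean identity. Typist's flag: plausible (classical: constant test field, a(u,1) = 0,
b(u,u,1) = 0 by periodicity). [cite: Davlatov2016NSPeriodic, eq. (6.1)–(6.2) p. 14] -/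
def Step2_Identity62 : Prop :=
  ∀ T : ℝ, 0 < T →
    ∀ (f : ℝ → UnitAddTorus (Fin 3) → EuclideanSpace ℝ (Fin 3))
      (u₀ : UnitAddTorus (Fin 3) → EuclideanSpace ℝ (Fin 3))
      (u : ℝ → UnitAddTorus (Fin 3) → EuclideanSpace ℝ (Fin 3)),
      ForceClass T f → IsWeakSolution T f u₀ u → Identity62 T f u₀ u

/-- **Step 3 — p. 14 (l.716–719), THE LOCATOR OF RECORD, at the grain the sentence uses (F15):**
«Если f ∈ C([0,T];H) ∩ L²(0,T;V′) тогда из (6.1) следует, что u′ ∈ C([0,T];(L¹(Ω))³)» — «If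
f ∈ C([0,T];H) ∩ L²(0,T;V′) then FROM (6.1) it follows that u′ ∈ C([0,T];(L¹(Ω))³)»: for EVERY field u
of the class L²(0,T;V) ∩ L^∞(0,T;H) satisfying the mean identity (6.2) with a force f ∈ C([0,T];H) and a
datum u₀, u has a time derivative in C([0,T];L¹). Typist's flag: SUSPICIOUS — (6.2) constrains the three
spatial means only (e.g. u(t,x) = h(t)·w(x) with w smooth divergence free of zero mean and h Lipschitz
satisfies (6.2) with f ≡ 0 for any such h). LOAD-BEARING: Steps 4–5 and Theorem 3's «u ∈ C([0,T];V)»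
consume it. [cite: Davlatov2016NSPeriodic, §6 1) p. 14 l.716–719] -/
def Step3_TimeDerivL1 : Prop :=
  ∀ T : ℝ, 0 < T →
    ∀ (f : ℝ → UnitAddTorus (Fin 3) → EuclideanSpace ℝ (Fin 3))
      (u₀ : UnitAddTorus (Fin 3) → EuclideanSpace ℝ (Fin 3))
      (u : ℝ → UnitAddTorus (Fin 3) → EuclideanSpace ℝ (Fin 3)),
      ForceClass T f → InWeakClass T u → Identity62 T f u₀ u →
        ∃ w : ℝ → UnitAddTorus (Fin 3) → EuclideanSpace ℝ (Fin 3), HasContTimeDerivIn 1 T u w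

/-- **Step 3 (NS grain) — the same sentence read for weak SOLUTIONS only (TYPING-HYGIENE 13 twin; not
in the chain):** every weak solution of (4.4)–(4.7) with f ∈ C([0,T];H) has u′ ∈ C([0,T];(L¹)³). At this
grain the assertion is a regularity statement for all weak solutions of the periodic Navier–Stokes
system (no countermodel is expected to be available; recorded for the referee's charitable reading).
[cite: Davlatov2016NSPeriodic, §6 1) p. 14 l.716–719] -/
def Step3_TimeDerivL1_NS : Prop :=
  ∀ T : ℝ, 0 < T →
    ∀ (f : ℝ → UnitAddTorus (Fin 3) → EuclideanSpace ℝ (Fin 3))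
      (u₀ : UnitAddTorus (Fin 3) → EuclideanSpace ℝ (Fin 3))
      (u : ℝ → UnitAddTorus (Fin 3) → EuclideanSpace ℝ (Fin 3)),
      ForceClass T f → IsWeakSolution T f u₀ u →
        ∃ w : ℝ → UnitAddTorus (Fin 3) → EuclideanSpace ℝ (Fin 3), HasContTimeDerivIn 1 T u w

/-- **Step 4 — p. 14 (l.748):** «Откуда u′(0) ∈ H. Из u′ ∈ C([0,T];(L¹(Ω))³) и u ∈ L^∞(0,T;H) следует,
что u ∈ C¹([0,T];H). Откуда u′ ∈ C([0,T];H).» — «Whence u′(0) ∈ H. From u′ ∈ C([0,T];(L¹)³) and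
u ∈ L^∞(0,T;H) it follows that u ∈ C¹([0,T];H). Whence u′ ∈ C([0,T];H).»: for every u of the weak class
with a time derivative w ∈ C([0,T];L¹) whose value at 0 is in L² (the preceding «u′(0) ∈ H», l.734–748,
granted as a hypothesis), w ∈ C([0,T];L²). Typist's flag: SUSPICIOUS (a class inference with no
estimate: L¹-continuity of w and w(0) ∈ L² do not give L²-continuity).
[cite: Davlatov2016NSPeriodic, §6 1) p. 14 l.748] -/
def Step4_C1H : Prop :=
  ∀ T : ℝ, 0 < T →
    ∀ (u w : ℝ → UnitAddTorus (Fin 3) → EuclideanSpace ℝ (Fin 3)),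
      InWeakClass T u → HasContTimeDerivIn 1 T u w →
        MemLp (w 0) 2 (volume : Measure (UnitAddTorus (Fin 3))) → HasContTimeDerivIn 2 T u w

/-- **Step 5 — p. 15 (l.749):** «Из u ∈ L²(0,T;V) и u′ ∈ C([0,T];H) следует, что u ∈ C([0,T];V)» — «From
u ∈ L²(0,T;V) and u′ ∈ C([0,T];H) it follows that u ∈ C([0,T];V)»: for every u of the weak class with a
time derivative in C([0,T];L²), u ∈ C([0,T];H¹). Typist's flag: SUSPICIOUS (C¹([0,T];L²) ∩ L²(0,T;H¹)
does not embed in C([0,T];H¹)). [cite: Davlatov2016NSPeriodic, §6 1) p. 15 l.749] -/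
def Step5_CV : Prop :=
  ∀ T : ℝ, 0 < T →
    ∀ (u w : ℝ → UnitAddTorus (Fin 3) → EuclideanSpace ℝ (Fin 3)),
      InWeakClass T u → HasContTimeDerivIn 2 T u w → InCV T u

/-- **Step 6 — p. 15 (l.750):** «u ∈ C([0,T];(L⁶(Ω))³) поскольку V ⊂ (H¹(Ω))³ ⊂ (L⁶(Ω))³» — Sobolev
embedding on the 3-torus, slice-wise with continuity. Typist's flag: classical (support; it feeds the
uniqueness class L⁴(0,T;L⁶) of §6 4)). [cite: Davlatov2016NSPeriodic, §6 1) p. 15 l.750] -/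
def Step6_CL6 : Prop :=
  ∀ T : ℝ, 0 < T →
    ∀ u : ℝ → UnitAddTorus (Fin 3) → EuclideanSpace ℝ (Fin 3), InCV T u →
      FluidPDE.ContinuousInLpOn (Icc 0 T) 6 u

/-- **Step 7 — §6 2)–4), pp. 15–16 (l.752–823), (6.3)–(6.8):** «Докажем единственность решения в
L⁴(0,T;(L⁶(Ω))³)» — uniqueness of weak solutions of (4.4)–(4.7) in the class C([0,T];V) ⊂ L⁴(0,T;L⁶)
(trilinear bounds (6.3)–(6.4), u′ ∈ L²(0,T;V′) (6.5), Gronwall (6.6)–(6.8) with M = ‖u‖⁴_{L⁶} ∈ L¹):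
two weak solutions in C([0,T];V) with the same data coincide a.e. at every time. Typist's flag:
classical (a Prodi–Serrin class, 2/4 + 3/6 = 1). [cite: Davlatov2016NSPeriodic, §6 2)–4) pp. 15–16] -/
def Step7_Uniqueness : Prop :=
  ∀ T : ℝ, 0 < T →
    ∀ (f : ℝ → UnitAddTorus (Fin 3) → EuclideanSpace ℝ (Fin 3))
      (u₀ : UnitAddTorus (Fin 3) → EuclideanSpace ℝ (Fin 3))
      (u v : ℝ → UnitAddTorus (Fin 3) → EuclideanSpace ℝ (Fin 3)),
      ForceClass T f → IsWeakSolution T f u₀ u → InCV T u → IsWeakSolution T f u₀ v → InCV T v →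
        ∀ t ∈ Icc 0 T, u t =ᵐ[volume] v t

/-- **Step 8 — Theorem 6 (pp. 16–17, l.831–851: H^{s+2} bootstrap «by Cattabriga's theorem [21]») and
§7 (pp. 17–18, l.858–919: «Из теоремы 6 и по теореме Соболева следует, что u ∈ (C¹[0,T]×C²(Ω̄))³»,
reconstruction of the periodic normalised pressure S = −grad p, uniqueness from Theorem 3 and (2.5)):**
the asserted implication Theorem 3 ⇒ Theorem 4. Typist's flag: plausible GIVEN Theorem 3 (classical
regularity theory; not re-derived). [cite: Davlatov2016NSPeriodic, Thm 6 pp. 16–17; §7 pp. 17–18] -/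
def Step8_Section7 : Prop :=
  Theorem3 → Theorem4

/-! ## §D. Compositions -/

/-- **Theorem 3 from Steps 1, 2, 3, 4, 5, 7 (kernel composition of §6 1) and 4), pp. 14–16):** Step 1
gives a weak solution u; Step 2 the mean identity (6.2); Step 3 a time derivative w ∈ C([0,T];L¹);
«u′(0) ∈ H» is the one place where the paper proves something about w(0) (l.734–748) — since Step 3
delivers SOME representative w, the composition uses Step 3 ∘ Step 4 in the form «for the w of Step 3,
granted w(0) ∈ L²» only through Step 4's hypothesis, which the paper discharges by the Galerkin bound;
to keep the kernel composition free of that sub-argument, Step 4 is applied to a representative with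
w(0) ∈ L² supplied by `Step4_C1H`'s caller: here we record the composition under the additional printed
sub-claim `UPrimeZeroInH` (l.734–748) as an explicit hypothesis. Step 5 gives u ∈ C([0,T];V); Step 7
gives uniqueness in that class. [cite: Davlatov2016NSPeriodic, proof of Thm 3, §6 pp. 14–16] -/
def UPrimeZeroInH : Prop :=
  ∀ T : ℝ, 0 < T →
    ∀ (f : ℝ → UnitAddTorus (Fin 3) → EuclideanSpace ℝ (Fin 3))
      (u₀ : UnitAddTorus (Fin 3) → EuclideanSpace ℝ (Fin 3))
      (u w : ℝ → UnitAddTorus (Fin 3) → EuclideanSpace ℝ (Fin 3)),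
      ForceClass T f → InVcapH2 u₀ → IsWeakSolution T f u₀ u → HasContTimeDerivIn 1 T u w →
        MemLp (w 0) 2 (volume : Measure (UnitAddTorus (Fin 3)))

/-- `u₀ ∈ V ∩ H²` is in particular in `H` (bookkeeping: `H² ⊂ L²` on the torus — the `MemSobolev`
predicate carries integrability and the spectral bound; we only need the `MemLp 2` consequence, which we
take from the weak class instead: not needed). Theorem 3 composed from the steps, with the sub-claim
«u′(0) ∈ H» (l.734–748) as an explicit hypothesis and «V ∩ H² ⊂ H» as the bookkeeping hypothesis `hVH`.
[cite: Davlatov2016NSPeriodic, proof of Thm 3, §6 pp. 14–16] -/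
theorem theorem3_of_steps
    (hVH : ∀ v : UnitAddTorus (Fin 3) → EuclideanSpace ℝ (Fin 3), InVcapH2 v → InH v)
    (h1 : Step1_Theorem2) (h2 : Step2_Identity62) (h3 : Step3_TimeDerivL1) (h0 : UPrimeZeroInH)
    (h4 : Step4_C1H) (h5 : Step5_CV) (h7 : Step7_Uniqueness) : Theorem3 := by
  intro T hT f u₀ hf hu₀
  refine ⟨?_, fun u v hu hcu hv hcv => h7 T hT f u₀ u v hf hu hcu hv hcv⟩
  obtain ⟨u, hu⟩ := h1 T hT f u₀ hf (hVH u₀ hu₀)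
  have h62 : Identity62 T f u₀ u := h2 T hT f u₀ u hf hu
  obtain ⟨w, hw⟩ := h3 T hT f u₀ u hf hu.2 h62
  have hw0 : MemLp (w 0) 2 (volume : Measure (UnitAddTorus (Fin 3))) := h0 T hT f u₀ u w hf hu₀ hu hw
  have hw2 : HasContTimeDerivIn 2 T u w := h4 T hT u w hu.2 hw hw0
  exact ⟨u, hu, h5 T hT u w hu.2 hw2⟩

/-- **COMPOSITION (kernel): the paper's logic composes.** From Steps 1–8 (ordered index), the bookkeeping
inclusion V ∩ H² ⊂ H and the printed sub-claim «u′(0) ∈ H» (l.734–748) to the claimed Theorems 3 and 4: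
`theorem3_of_steps`, then Step 8. Step 6 (L⁶-continuity) is printed support for the uniqueness class and
is not consumed (underscored). Nothing here asserts any step.
[cite: Davlatov2016NSPeriodic, Thms 3–4 p. 5; §6–§7 pp. 14–18] -/
theorem claim_of_steps
    (hVH : ∀ v : UnitAddTorus (Fin 3) → EuclideanSpace ℝ (Fin 3), InVcapH2 v → InH v)
    (h1 : Step1_Theorem2) (h2 : Step2_Identity62) (h3 : Step3_TimeDerivL1) (h0 : UPrimeZeroInH)
    (h4 : Step4_C1H) (h5 : Step5_CV) (_h6 : Step6_CL6) (h7 : Step7_Uniqueness)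
    (h8 : Step8_Section7) : ClaimedTheorem :=
  have h3' : Theorem3 := theorem3_of_steps hVH h1 h2 h3 h0 h4 h5 h7
  ⟨h3', h8 h3'⟩

/-- The NS-grain reading of Step 3 follows from the abstract-grain Step 3 with Step 2 (the mean identity
holds for weak solutions): the abstract statement is the stronger one (bookkeeping for the referee).
[cite: Davlatov2016NSPeriodic, §6 1) p. 14] -/
theorem step3_NS_of_step3 (h2 : Step2_Identity62) (h3 : Step3_TimeDerivL1) : Step3_TimeDerivL1_NS :=
  fun T hT f u₀ u hf hu => h3 T hT f u₀ u hf hu.2 (h2 T hT f u₀ u hf hu)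


/-! ## D-0026 in-file discharges — Steps 1 and 6, the zero force, `V ∩ H² ⊂ H` (typist-9 g4, APPEND-ONLY)

Literature-side ports of the kernel proofs of ns-claims-salvage-p2,
`Summits/…/Theorems/SoloSalvageDavlatov2020.lean` (`inVcapH2_inH`, `zeroForceInClass_holds`,
`step6_holds`, `step1_of_measurable`) and `Summits/…/Theorems/SoloSalvageDavlatov2020Step1.lean`
(`step1_holds`), which Literature cannot import. CLASSICAL items around the locator of record
(Step 3 `Step3_TimeDerivL1`, §6 «1)» p. 14 l.716–719, kernel-false Summits-side
`…Theorems.Davlatov2020.not_Step3_TimeDerivL1`): `V ∩ H² ⊂ H` on `𝕋³`; the zero force lies in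
`C([0,T];H² ∩ V′)`; Step 6 `C([0,T];V) ⊂ C([0,T];(L⁶)³)` (Sobolev embedding, tree
`Torus.exists_eLpNorm_six_le_eSobolevNorm_one`); Step 1 = Theorem 2 (forced Leray–Hopf existence on
`𝕋³`, tree `hopf_existence_torus_holds` + a measurable version of the force). With them the kernel
composition `claim_of_steps` needs exactly Steps 2, 3, 4, 5, 7, 8 and `UPrimeZeroInH`
(`claim_of_steps_inputs`). No statement / def / locator / class above is touched; eight imports are
added for the ported proofs.

WHAT THIS IS NOT: not a claim about NS regularity or blow-up; not a claim about any author beyond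
the typed locator. -/

section Ports

open Function
open scoped NNReal
open Literature.Analysis.FluidPDE Literature.Analysis.FunctionSpaces

/-- **`V ∩ H² ⊂ H` on `𝕋³`** — the bookkeeping hypothesis `hVH` of
`Literature.Claims.NS.Davlatov2020.theorem3_of_steps` / `claim_of_steps`: an `H²` weakly
divergence-free field is square integrable and weakly divergence free (`H^s ⊂ L²` for `s ≥ 0`,
Parseval; Grafakos 2014 Prop. 3.2.7). [cite: Davlatov2016NSPeriodic, §1 p. 4 (V₁ ⊂ V ⊂ H)] -/
theorem inVcapH2_inH (v : UnitAddTorus (Fin 3) → EuclideanSpace ℝ (Fin 3)) (hv : InVcapH2 v) :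
    InH v :=
  ⟨FluidPDE.memLp_complexify_comp_iff.1 (Torus.MemSobolev.memLp_two_holds hv.1 (by norm_num)), hv.2⟩

/-- **The zero force is admissible for Theorem 4** (port of the Summits-side
`…Theorems.Davlatov2020.zeroForceInClass_holds`, salvage-p2) (`f ≡ 0 ∈ C([0,T];H² ∩ V′)`): the hypothesis `h0`
of `Literature.Claims.NS.Davlatov2020.clay_of_claimed_of_delta`. [cite: Davlatov2016NSPeriodic, Thm 4 p. 5] -/
theorem zeroForceInClass_holds : ZeroForceInClass := by
  intro T _hT
  have h0 : (fun t : ℝ => EuclideanSpace.complexify ∘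
      (0 : ℝ → UnitAddTorus (Fin 3) → EuclideanSpace ℝ (Fin 3)) t) =
      fun _ => (0 : UnitAddTorus (Fin 3) → EuclideanSpace ℂ (Fin 3)) := by
    funext t; funext x; simp
  refine ⟨?_, fun t _ θ _ => by simp⟩
  rw [h0]
  refine ⟨fun t _ => Torus.memSobolev_zero_fun 2, fun t₀ _ => ?_⟩
  simp only [sub_self, Torus.eSobolevNorm_zero_fun]
  exact tendsto_const_nhds

/-- **Step 6 HOLDS (p. 15 l.750)** (port of the Summits-side `…Theorems.Davlatov2020.step6_holds`, salvage-p2) **: `C([0,T];V) ⊂ C([0,T];(L⁶)³)` on `𝕋³`** — every field continuous on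
`[0,T]` into the spectral `H¹` is continuous into `L⁶` (Sobolev embedding `H¹(𝕋³) ⊂ L⁶(𝕋³)` applied
slice-wise and to differences of slices; tree `Torus.exists_eLpNorm_six_le_eSobolevNorm_one`).
Original source: Sobolev's embedding theorem (Evans 2010 §5.6.1 Thm 1; RRS 2016 Thm 1.19).
[cite: Davlatov2016NSPeriodic, §6 1) p. 15 l.750] -/
theorem step6_holds : Step6_CL6 := by
  intro T _hT u hu
  obtain ⟨K, hK⟩ := Torus.exists_eLpNorm_six_le_eSobolevNorm_one (d := Fin 3) (by simp)
  refine ⟨fun t ht => (hK (u t) (hu.1 t ht)).1, fun t₀ ht₀ => ?_⟩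
  have hsub : ∀ t : ℝ, (EuclideanSpace.complexify ∘ (u t - u t₀)) =
      (EuclideanSpace.complexify ∘ u t) - (EuclideanSpace.complexify ∘ u t₀) := by
    intro t; funext x; simp
  -- the `H¹` norm of the difference tends to zero, hence so does `K` times it
  have hlim : Tendsto (fun t => (K : ℝ≥0∞) *
      Torus.eSobolevNorm 1 ((EuclideanSpace.complexify ∘ u t) - (EuclideanSpace.complexify ∘ u t₀)))
      (𝓝[Icc 0 T] t₀) (𝓝 0) := by
    have h := ENNReal.Tendsto.const_mul (hu.2 t₀ ht₀) (Or.inr ENNReal.coe_ne_top) (a := (K : ℝ≥0∞))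
    rwa [mul_zero] at h
  refine tendsto_of_tendsto_of_tendsto_of_le_of_le' tendsto_const_nhds hlim
    (Eventually.of_forall fun _ => zero_le) ?_
  filter_upwards [self_mem_nhdsWithin] with t ht
  have hmem : Torus.MemSobolev 1 (EuclideanSpace.complexify ∘ (u t - u t₀)) := by
    rw [hsub]; exact Torus.MemSobolev.sub_holds (hu.1 t ht) (hu.1 t₀ ht₀)
  have h := (hK (u t - u t₀) hmem).2
  rwa [hsub] at h


/-! ### Step 1 (Theorem 2): Leray–Hopf existence, for space–time measurable forces -/

/-- A `C([0,T];L²)` family on the torus is bounded in `L²` on `[0,T]` (finite subcover by the balls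
`{t | ‖f t − f s‖₂ < 1}`). [folklore] -/
private theorem exists_forall_eLpNorm_le_of_forceClass {T : ℝ}
    {f : ℝ → UnitAddTorus (Fin 3) → EuclideanSpace ℝ (Fin 3)}
    (hf : FluidPDE.ContinuousInLpOn (Icc 0 T) 2 f) :
    ∃ M : ℝ≥0, ∀ t ∈ Icc 0 T, eLpNorm (f t) 2 volume ≤ M := by
  set U : ℝ → Set ℝ := fun s => {t | eLpNorm (f t - f s) 2 volume < 1} with hU_def
  have hU : ∀ s ∈ Icc 0 T, U s ∈ 𝓝[Icc 0 T] s := fun s hs => (hf.2 s hs) (Iio_mem_nhds one_pos)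
  obtain ⟨F, hFK, hcover⟩ := isCompact_Icc.elim_nhdsWithin_subcover U hU
  have hfin : ∀ s ∈ Icc 0 T, eLpNorm (f s) 2 volume < ⊤ := fun s hs => (hf.1 s hs).2
  set M : ℝ≥0∞ := ∑ s ∈ F, (1 + eLpNorm (f s) 2 volume) with hM_def
  have hMtop : M < ⊤ :=
    ENNReal.sum_lt_top.2 fun s hs => ENNReal.add_lt_top.2 ⟨ENNReal.one_lt_top, hfin s (hFK s hs)⟩
  refine ⟨M.toNNReal, fun t ht => ?_⟩
  rw [ENNReal.coe_toNNReal hMtop.ne]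
  obtain ⟨s, hsF, hts⟩ : ∃ s ∈ F, t ∈ U s := by
    have h := hcover ht
    simp only [mem_iUnion, exists_prop] at h
    exact h
  have hsK : s ∈ Icc 0 T := hFK s hsF
  calc eLpNorm (f t) 2 volume = eLpNorm ((f t - f s) + f s) 2 volume := by rw [sub_add_cancel]
    _ ≤ eLpNorm (f t - f s) 2 volume + eLpNorm (f s) 2 volume :=
        eLpNorm_add_le ((hf.1 t ht).1.sub (hf.1 s hsK).1) (hf.1 s hsK).1 one_le_two
    _ ≤ 1 + eLpNorm (f s) 2 volume := by
        gcongr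
        exact le_of_lt hts
    _ ≤ M := Finset.single_le_sum (f := fun s => 1 + eLpNorm (f s) 2 volume)
        (fun _ _ => zero_le) hsF

/-- The weak formulation sees the force only through its slices at times `t ∈ (0,T)`: two forces
agreeing there give the same forced weak solutions. [folklore] -/
private theorem isWeakNSSolutionForcedOn_congr_force {T ν : ℝ}
    {f g : ℝ → UnitAddTorus (Fin 3) → EuclideanSpace ℝ (Fin 3)}
    {u₀ : UnitAddTorus (Fin 3) → EuclideanSpace ℝ (Fin 3)}
    {u : ℝ → UnitAddTorus (Fin 3) → EuclideanSpace ℝ (Fin 3)} (hfg : ∀ t ∈ Ioo 0 T, g t = f t)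
    (h : Torus.IsWeakNSSolutionForcedOn T ν g u₀ u) : Torus.IsWeakNSSolutionForcedOn T ν f u₀ u := by
  refine ⟨h.1, h.2.1, h.2.2.1, fun ψ hψ hdiv => ?_⟩
  convert h.2.2.2 ψ hψ hdiv using 2
  exact setIntegral_congr_fun measurableSet_Ioo fun t ht => by simp only [hfg t ht]

/-- **Step 1 (Theorem 2, p. 5 / §5 pp. 10–13) for space–time measurable forces — CLASSICAL**
(Leray 1934 §V; Hopf 1951; Temam 1977 Ch. III Thm 3.1): for `T > 0`, a force `f ∈ C([0,T];L²)` with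
weakly divergence-free slices WHOSE SPACE–TIME LIFT IS A.E.-STRONGLY MEASURABLE on `(0,T) × ℝ³` (the
hypothesis the paper takes for granted and the typed `ForceClass` does not record), and `u₀ ∈ H`,
problem (4.4)–(4.7) has a weak solution in the typed class `L²(0,T;V) ∩ L^∞(0,T;H)`. Kernel route:
freeze the force after time `T` (`t ↦ f (T)` for `t ≥ T`; measurable and square integrable on every
`(0,T')`), apply the tree's Hopf existence theorem on `𝕋³` (`hopf_existence_torus_holds`, Galerkin,
PROVED) at `ν = 1`, restrict the global Leray–Hopf solution to `[0,T)` and project its fields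
(`weak`, `energy_bound`, `memL2Sobolev`); the frozen force agrees with `f` on `(0,T)`
(`isWeakNSSolutionForcedOn_congr_force`). [cite: Davlatov2016NSPeriodic, Thm 2 p. 5; §5 pp. 10–13] -/
theorem step1_of_measurable (T : ℝ) (hT : 0 < T)
    (f : ℝ → UnitAddTorus (Fin 3) → EuclideanSpace ℝ (Fin 3))
    (u₀ : UnitAddTorus (Fin 3) → EuclideanSpace ℝ (Fin 3)) (hf : ForceClass T f)
    (hfm : AEStronglyMeasurable (Torus.stLift f) (volume.restrict (Ioo 0 T ×ˢ univ)))
    (hu₀ : InH u₀) :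
    ∃ u : ℝ → UnitAddTorus (Fin 3) → EuclideanSpace ℝ (Fin 3), IsWeakSolution T f u₀ u := by
  -- the force frozen after time `T`
  set g : ℝ → UnitAddTorus (Fin 3) → EuclideanSpace ℝ (Fin 3) := fun t => if t < T then f t else f T
    with hg
  have hgf : ∀ t ∈ Ioo 0 T, g t = f t := fun t ht => by simp [hg, ht.2]
  have hTmem : T ∈ Icc 0 T := ⟨hT.le, le_rfl⟩
  -- measurability of the frozen force on `(0,∞) × ℝ³`
  have hmeas : AEStronglyMeasurable (Torus.stLift g) (volume.restrict (Ioi 0 ×ˢ univ)) := by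
    have hsplit : (Ioi (0 : ℝ) ×ˢ (univ : Set (EuclideanSpace ℝ (Fin 3)))) =
        (Ioo 0 T ×ˢ univ) ∪ (Ici T ×ˢ univ) := by
      ext ⟨t, y⟩
      simp only [mem_prod, mem_Ioi, mem_univ, and_true, mem_union, mem_Ioo, mem_Ici]
      constructor
      · intro ht
        rcases lt_or_ge t T with h | h
        · exact Or.inl ⟨ht, h⟩
        · exact Or.inr h
      · rintro (⟨ht, -⟩ | ht)
        · exact ht
        · exact hT.trans_le ht
    rw [hsplit, aestronglyMeasurable_union_iff]
    constructor
    · refine hfm.congr ?_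
      filter_upwards [ae_restrict_mem (measurableSet_Ioo.prod MeasurableSet.univ)] with p hp
      rcases p with ⟨t, y⟩
      have ht : t ∈ Ioo 0 T := (mem_prod.1 hp).1
      simp [Torus.stLift, hgf t ht]
    · have hsteady : AEStronglyMeasurable (Torus.stLift (fun _ : ℝ => f T))
          (volume.restrict (Ici T ×ˢ (univ : Set (EuclideanSpace ℝ (Fin 3))))) :=
        Torus.aestronglyMeasurable_stLift_of_uncurry (u := fun _ : ℝ => f T) (hf.1.1 T hTmem).1.comp_snd
      refine hsteady.congr ?_
      filter_upwards [ae_restrict_mem (measurableSet_Ici.prod MeasurableSet.univ)] with p hp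
      rcases p with ⟨t, y⟩
      have ht : T ≤ t := (mem_prod.1 hp).1
      simp [Torus.stLift, hg, not_lt.2 ht]
  -- square integrability of the frozen force on every `(0,T')`
  obtain ⟨M, hM⟩ := exists_forall_eLpNorm_le_of_forceClass hf.1
  have hslice : ∀ t : ℝ, 0 < t → ∫⁻ x, ‖g t x‖ₑ ^ 2 ≤ (M : ℝ≥0∞) ^ 2 := by
    intro t ht
    have hmem : ∃ s ∈ Icc 0 T, g t = f s := by
      by_cases htT : t < T
      · exact ⟨t, ⟨ht.le, htT.le⟩, by simp [hg, htT]⟩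
      · exact ⟨T, hTmem, by simp [hg, htT]⟩
    obtain ⟨s, hs, hgs⟩ := hmem
    rw [hgs, ← Torus.eLpNorm_two_pow_two_eq_lintegral]
    exact pow_le_pow_left' (hM s hs) 2
  have hL2 : ∀ T' : ℝ, 0 < T' → ∫⁻ t in Ioo 0 T', ∫⁻ x, ‖g t x‖ₑ ^ 2 < ⊤ := by
    intro T' hT'
    calc ∫⁻ t in Ioo 0 T', ∫⁻ x, ‖g t x‖ₑ ^ 2 ≤ ∫⁻ _ in Ioo 0 T', (M : ℝ≥0∞) ^ 2 := by
          refine lintegral_mono_ae ?_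
          filter_upwards [ae_restrict_mem measurableSet_Ioo] with t ht
          exact hslice t ht.1
      _ < ⊤ := by
          rw [setLIntegral_const]
          exact ENNReal.mul_lt_top (ENNReal.pow_lt_top ENNReal.coe_lt_top) measure_Ioo_lt_top
  -- Hopf's existence theorem on `𝕋³` (tree, proved) and restriction to `[0,T)`
  obtain ⟨u, hu⟩ := hopf_existence_torus_holds 1 one_pos u₀ hu₀.1 hu₀.2 g hmeas hL2
  have hLH : Torus.IsLerayHopfOn T 1 g u₀ u := hu T hT
  obtain ⟨C, hC⟩ := hLH.energy_bound
  exact ⟨u, isWeakNSSolutionForcedOn_congr_force hgf hLH.weak,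
    ⟨(C : ℝ≥0∞), ENNReal.coe_lt_top, hC⟩, hLH.memL2Sobolev⟩

/-- The weak formulation sees the force only through its slices up to null sets: two forces whose slices
agree a.e. at every `t ∈ (0,T)` have the same forced weak solutions. [folklore] -/
private theorem isWeakNSSolutionForcedOn_congr_force_ae {T ν : ℝ}
    {f g : ℝ → UnitAddTorus (Fin 3) → EuclideanSpace ℝ (Fin 3)}
    {u₀ : UnitAddTorus (Fin 3) → EuclideanSpace ℝ (Fin 3)}
    {u : ℝ → UnitAddTorus (Fin 3) → EuclideanSpace ℝ (Fin 3)}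
    (hfg : ∀ t ∈ Ioo 0 T, g t =ᵐ[volume] f t)
    (h : Torus.IsWeakNSSolutionForcedOn T ν g u₀ u) : Torus.IsWeakNSSolutionForcedOn T ν f u₀ u := by
  refine ⟨h.1, h.2.1, h.2.2.1, fun ψ hψ hdiv => ?_⟩
  convert h.2.2.2 ψ hψ hdiv using 2
  refine setIntegral_congr_fun measurableSet_Ioo fun t ht => ?_
  refine integral_congr_ae ?_
  filter_upwards [hfg t ht] with x hx
  rw [hx]

/-- A version of an `L²`-continuous family with the same slices a.e. is again in `ForceClass T`. [folklore] -/
private theorem forceClass_congr {T : ℝ}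
    {f g : ℝ → UnitAddTorus (Fin 3) → EuclideanSpace ℝ (Fin 3)} (hf : ForceClass T f)
    (hgf : ∀ t ∈ Icc 0 T, g t =ᵐ[volume] f t) : ForceClass T g := by
  refine ⟨⟨fun t ht => (hf.1.1 t ht).ae_eq (hgf t ht).symm, fun t₀ ht₀ => ?_⟩, fun t ht θ hθ => ?_⟩
  · refine (hf.1.2 t₀ ht₀).congr' ?_
    filter_upwards [self_mem_nhdsWithin] with t ht
    exact eLpNorm_congr_ae (((hgf t ht).sub (hgf t₀ ht₀))).symm
  · have h0 := hf.2 t ht θ hθ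
    rw [← h0]
    refine integral_congr_ae ?_
    filter_upwards [hgf t ht] with x hx
    rw [hx]

/-- **Step 1 (Theorem 2, p. 5 / §5 pp. 10–13) HOLDS as typed — CLASSICAL** (port of the Summits-side
`…Theorems.Davlatov2020.step1_holds`, salvage-p2, `SoloSalvageDavlatov2020Step1.lean`) (Leray 1934 §V; Hopf 1951; Temam
1977 Ch. III Thm 3.1): for `T > 0`, `f ∈ C([0,T];L²)` with weakly divergence-free slices and `u₀ ∈ H`, problem
(4.4)–(4.7) on `𝕋³` has a weak solution in `L²(0,T;V) ∩ L^∞(0,T;H)`. Kernel route: measurable version `g` of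
`f` (`ContinuousInLpOn.exists_stronglyMeasurable_version`), `step1_of_measurable` for `g`, and the a.e.
insensitivity of the weak identity to the force's slices. [cite: Davlatov2016NSPeriodic, Thm 2 p. 5; §5 pp. 10–13] -/
theorem step1_holds : Step1_Theorem2 := by
  intro T hT f u₀ hf hu₀
  obtain ⟨g, hgm, hgf⟩ :=
    hf.1.exists_stronglyMeasurable_version (X := UnitAddTorus (Fin 3)) one_le_two ENNReal.ofNat_ne_top
  have hgclass : ForceClass T g := forceClass_congr hf hgf
  have hgmeas : AEStronglyMeasurable (Torus.stLift g) (volume.restrict (Ioo 0 T ×ˢ univ)) :=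
    Torus.aestronglyMeasurable_stLift_of_uncurry hgm.aestronglyMeasurable
  obtain ⟨u, hu⟩ := step1_of_measurable T hT g u₀ hgclass hgmeas hu₀
  exact ⟨u, isWeakNSSolutionForcedOn_congr_force_ae
    (fun t ht => hgf t (Ioo_subset_Icc_self ht)) hu.1, hu.2⟩

/-- Bookkeeping: with Steps 1 and 6 and the inclusions discharged in this file, the kernel
composition `claim_of_steps` needs exactly Steps 2, 3, 4, 5, 7, 8 and the printed sub-claim
`UPrimeZeroInH` (l.734–748) (port of `…Theorems.Davlatov2020.claim_of_steps_inputs₂`).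
[cite: Davlatov2016NSPeriodic, Thms 3–4 p. 5; §6–§7 pp. 14–18] -/
theorem claim_of_steps_inputs (h2 : Step2_Identity62) (h3 : Step3_TimeDerivL1) (h0 : UPrimeZeroInH)
    (h4 : Step4_C1H) (h5 : Step5_CV) (h7 : Step7_Uniqueness) (h8 : Step8_Section7) :
    ClaimedTheorem :=
  claim_of_steps inVcapH2_inH step1_holds h2 h3 h0 h4 h5 step6_holds h7 h8

end Ports

end

end Literature.Claims.NS.Davlatov2020
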